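import Summits.NavierStokesRegularity.NavierStokesRegularity.Theorems.FilamentSkeletonRssCoreLinearInvertibilityArnoldModeOne1D
import Summits.NavierStokesRegularity.NavierStokesRegularity.Theorems.FilamentSkeletonRssCoreLinearInvertibilityArnoldModeSplit
import Summits.NavierStokesRegularity.NavierStokesRegularity.Theorems.FilamentSkeletonRssCoreLinearInvertibilityArnoldHighModes
import Literature.Analysis.FluidPDE.ArnoldCoercivityGaussianVortex
import Literature.Analysis.FluidPDE.PineauVicolWeightedIdentity

/-!
# Crux `CoreLinearInvertibility` (stmt-NavierStokesRegularity-17973), line `Sketch`, stub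
# `stub_gallaySverak2021`: Gallay–Šverák's Theorem 2.5 at the Gaussian vortex, PROVED

The named Literature fact `GallaySverak2021_thm25_gaussian` (coercivity of Arnold's quadratic form
`2J(ω) = ∫ Φ⁻¹ ω² + ∫ ω ψ_ω` on continuous, odd, Gaussian-class densities with vanishing first moments,
`Φ = kerWeight = 1/𝒜`) is assembled from the three landed stubs of wave 3:

* `stub_arnoldModeSplit`: `ω = ω₁ + ω_r` with `ω₁ = (a(|x|) x₀ + b(|x|) x₁)/|x|` the `k = ±1` part;
  `∫ Φ⁻¹ ω² = π ∫ Φ⁻¹ (a² + b²) r dr + ∫ Φ⁻¹ ω_r²` and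
  `∫ ω ψ_ω = −π ∫ ((B₁a) a + (B₁b) b) r dr + ∫ ω_r ψ_{ω_r}`, `(B₁a)(r) = ½ ∫ min(r/s, s/r) a(s) s ds`,
  with the moment constraints `∫ r² a = ∫ r² b = 0` and the vanishing `k = ±1` coefficients of `ω_r`;
* `stub_arnoldModeOne1D`: `γ₁ ∫ Φ⁻¹ a² r ≤ ∫ Φ⁻¹ a² r − ∫ (B₁a) a r` under `∫ r² a = 0` (same for `b`);
* `stub_arnoldHighModes`: `∫ ω_r ψ_{ω_r} ≥ −(19/20) ∫ Φ⁻¹ ω_r²`.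

Hence with `γ = min(γ₁, 1/20)`: `2J(ω) ≥ π γ₁ ∫ Φ⁻¹(a²+b²) r + (1/20) ∫ Φ⁻¹ ω_r² ≥ γ ∫ Φ⁻¹ ω²`.
The only work here is splitting the one-dimensional integrals (integrability of `Φ⁻¹ a² r` and of
`(B₁a) a r` on `(0, ∞)` from the Gaussian bounds on `a`, `b`).

## References

* Th. Gallay, V. Šverák, *Arnold's variational principle and its application to the stability of
  planar vortices*, arXiv:2110.13739 = Analysis & PDE 17 (2024) 681–722, Thm. 2.5, Rem. 2.7,
  §2.1 (proof: Fourier decomposition in the angle), §4.1 Lemma 4.1. [GallaySverak2021]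
-/

set_option linter.dupNamespace false

noncomputable section

namespace Summit.NavierStokesRegularity.NavierStokesRegularity.Theorems

open Set Function Filter MeasureTheory Topology Metric
open Literature.Analysis.FluidPDE
open scoped InnerProductSpace Real

/-! ### One-dimensional integrability from Gaussian bounds -/

/-- A measurable function on `(0, ∞)` below a Gaussian-class bound `C (1+r)^k e^{−r²/4}` is integrable
on `(0, ∞)` (`(1+r)^k e^{−r²/4} ≤ K e^{−r²/8}`). [folklore] -/
theorem arnoldGauss_integrableOn_of_gaussBound {f : ℝ → ℝ}
    (hf : AEStronglyMeasurable f (volume.restrict (Ioi (0:ℝ)))) {C : ℝ} (hC : 0 ≤ C) (k : ℕ)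
    (hb : ∀ r, 0 < r → |f r| ≤ C * (1 + r) ^ k * Real.exp (-(r ^ 2 / 4))) :
    IntegrableOn f (Ioi 0) := by
  obtain ⟨K, hK⟩ : ∃ K : ℝ, K = (k.factorial * (4 / (1 / 4 : ℝ)) ^ k * Real.exp ((1 / 4 : ℝ) / 2)) := ⟨_, rfl⟩
  have hG : Integrable fun t : ℝ => Real.exp (-((1 / 4 : ℝ) / 2) * t ^ 2) :=
    integrable_exp_neg_mul_sq (by norm_num)
  refine Integrable.mono' ((hG.const_mul (C * K)).integrableOn) hf ?_
  refine (ae_restrict_iff' measurableSet_Ioi).2 (Eventually.of_forall fun r hr => ?_)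
  rw [Real.norm_eq_abs]
  have h1 := PineauVicol2026.one_add_pow_mul_exp_neg_mul_sq_le (c := 1 / 4) (by norm_num) k (le_of_lt hr)
  rw [← hK] at h1
  have e : Real.exp (-(r ^ 2 / 4)) = Real.exp (-(1 / 4) * r ^ 2) := by congr 1; ring
  calc |f r| ≤ C * ((1 + r) ^ k * Real.exp (-(1 / 4) * r ^ 2)) := by rw [← e, ← mul_assoc]; exact hb r hr
    _ ≤ C * (K * Real.exp (-((1 / 4) / 2) * r ^ 2)) := mul_le_mul_of_nonneg_left h1 hC
    _ = C * K * Real.exp (-((1 / 4) / 2) * r ^ 2) := by ring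

section Radial

variable {a : ℝ → ℝ} (hac : ContinuousOn a (Ici 0)) {C : ℝ} {N : ℕ}
  (hab : ∀ r : ℝ, 0 ≤ r → |a r| ≤ C * (1 + r) ^ N * Real.exp (-(r ^ 2 / 4)))

include hac hab in
/-- `s ↦ |a(s)| s` is integrable on `(0, ∞)`. [folklore] -/
theorem arnoldGauss_integrableOn_abs_mul : IntegrableOn (fun s => |a s| * s) (Ioi 0) := by
  have hC : 0 ≤ C := by
    have h := hab 0 le_rfl
    simp only [add_zero, one_pow, mul_one, ne_eq, OfNat.ofNat_ne_zero, not_false_eq_true, zero_pow,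
      zero_div, neg_zero, Real.exp_zero] at h
    exact (abs_nonneg _).trans h
  refine arnoldGauss_integrableOn_of_gaussBound
    (((continuous_abs.comp_continuousOn (hac.mono Ioi_subset_Ici_self)).mul continuousOn_id).aestronglyMeasurable
      measurableSet_Ioi) hC (N + 1) fun s hs => ?_
  rw [abs_of_nonneg (mul_nonneg (abs_nonneg _) hs.le)]
  calc |a s| * s ≤ (C * (1 + s) ^ N * Real.exp (-(s ^ 2 / 4))) * (1 + s) :=
        mul_le_mul (hab s hs.le) (by linarith) hs.le (by positivity)
    _ = C * (1 + s) ^ (N + 1) * Real.exp (-(s ^ 2 / 4)) := by ring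

include hac hab in
/-- **`r ↦ Φ(r)⁻¹ a(r)² r` is integrable on `(0, ∞)`** (`Φ⁻¹ ≤ e^{r²/4}`). [folklore] -/
theorem arnoldGauss_integrableOn_normIntegrand :
    IntegrableOn (fun r => (kerWeight r)⁻¹ * a r ^ 2 * r) (Ioi 0) := by
  have hC : 0 ≤ C := by
    have h := hab 0 le_rfl
    simp only [add_zero, one_pow, mul_one, ne_eq, OfNat.ofNat_ne_zero, not_false_eq_true, zero_pow,
      zero_div, neg_zero, Real.exp_zero] at h
    exact (abs_nonneg _).trans h
  have hcont : ContinuousOn (fun r => (kerWeight r)⁻¹ * a r ^ 2 * r) (Ioi 0) :=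
    (((continuous_kerWeight.continuousOn.inv₀ fun r _ => (kerWeight_pos r).ne').mul
      ((hac.mono Ioi_subset_Ici_self).pow 2)).mul continuousOn_id)
  refine arnoldGauss_integrableOn_of_gaussBound (hcont.aestronglyMeasurable measurableSet_Ioi)
    (sq_nonneg C) (2 * N + 1) fun r hr => ?_
  have hΦ := kerWeight_pos r
  rw [abs_of_nonneg (mul_nonneg (mul_nonneg (inv_nonneg.2 hΦ.le) (sq_nonneg _)) hr.le)]
  have h1 := arnold_inv_kerWeight_le r
  have h2 : a r ^ 2 ≤ (C * (1 + r) ^ N * Real.exp (-(r ^ 2 / 4))) ^ 2 := by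
    rw [← sq_abs]; exact pow_le_pow_left₀ (abs_nonneg _) (hab r hr.le) 2
  have h3 : Real.exp (r ^ 2 / 4) * Real.exp (-(r ^ 2 / 4)) ^ 2 = Real.exp (-(r ^ 2 / 4)) := by
    rw [pow_two (Real.exp (-(r ^ 2 / 4))), ← Real.exp_add, ← Real.exp_add]; congr 1; ring
  have h4 : 0 ≤ C ^ 2 * (1 + r) ^ (2 * N) * Real.exp (-(r ^ 2 / 4)) := by positivity
  calc (kerWeight r)⁻¹ * a r ^ 2 * r
      ≤ Real.exp (r ^ 2 / 4) * (C * (1 + r) ^ N * Real.exp (-(r ^ 2 / 4))) ^ 2 * r :=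
        mul_le_mul_of_nonneg_right (mul_le_mul h1 h2 (sq_nonneg _) (Real.exp_pos _).le) hr.le
    _ = C ^ 2 * (1 + r) ^ (2 * N) * (Real.exp (r ^ 2 / 4) * Real.exp (-(r ^ 2 / 4)) ^ 2) * r := by ring
    _ = C ^ 2 * (1 + r) ^ (2 * N) * Real.exp (-(r ^ 2 / 4)) * r := by rw [h3]
    _ ≤ C ^ 2 * (1 + r) ^ (2 * N) * Real.exp (-(r ^ 2 / 4)) * (1 + r) :=
        mul_le_mul_of_nonneg_left (by linarith) h4
    _ = C ^ 2 * (1 + r) ^ (2 * N + 1) * Real.exp (-(r ^ 2 / 4)) := by ring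

/-- The mode kernel `min(r/s, s/r) ∈ [0, 1]` for `r, s > 0`. [folklore] -/
theorem arnoldGauss_min_mem_Icc {r s : ℝ} (hr : 0 < r) (hs : 0 < s) : min (r / s) (s / r) ∈ Icc (0:ℝ) 1 := by
  refine ⟨le_min (div_nonneg hr.le hs.le) (div_nonneg hs.le hr.le), ?_⟩
  rcases le_total r s with h | h
  · exact (min_le_left _ _).trans ((div_le_one hs).2 h)
  · exact (min_le_right _ _).trans ((div_le_one hr).2 h)

include hac in
/-- **Measurability of `B₁a`** on `(0, ∞)`: `r ↦ ∫_{(0,∞)} min(r/s, s/r) a(s) s ds` (the kernel times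
`a(s) s` is continuous on `(0,∞)²`; marginal of an a.e.-strongly measurable function). [folklore] -/
theorem arnoldGauss_aestronglyMeasurable_B1 :
    AEStronglyMeasurable (fun r => ∫ s in Ioi (0:ℝ), min (r / s) (s / r) * a s * s)
      (volume.restrict (Ioi (0:ℝ))) := by
  set F : ℝ × ℝ → ℝ := fun p => min (p.1 / p.2) (p.2 / p.1) * a p.2 * p.2 with hF
  have hFc : ContinuousOn F (Ioi (0:ℝ) ×ˢ Ioi (0:ℝ)) := by
    refine ContinuousOn.mul (ContinuousOn.mul ?_ ?_) continuousOn_snd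
    · exact continuous_min.comp_continuousOn
        ((continuousOn_fst.div continuousOn_snd fun p hp => ne_of_gt hp.2).prodMk
          (continuousOn_snd.div continuousOn_fst fun p hp => ne_of_gt hp.1))
    · exact hac.comp continuousOn_snd fun p hp => Ioi_subset_Ici_self hp.2
  have hFm : AEStronglyMeasurable F ((volume.restrict (Ioi (0:ℝ))).prod (volume.restrict (Ioi (0:ℝ)))) := by
    rw [Measure.prod_restrict]
    exact hFc.aestronglyMeasurable (measurableSet_Ioi.prod measurableSet_Ioi)
  exact hFm.integral_prod_right'

include hac hab in
/-- **`r ↦ (B₁a)(r) a(r) r` is integrable on `(0, ∞)`** (`|(B₁a)(r)| ≤ ½ ∫ |a(s)| s ds`). [folklore] -/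
theorem arnoldGauss_integrableOn_energyIntegrand :
    IntegrableOn (fun r => ((1 / 2 : ℝ) * ∫ s in Ioi (0:ℝ), min (r / s) (s / r) * a s * s) * a r * r) (Ioi 0) := by
  have hC : 0 ≤ C := by
    have h := hab 0 le_rfl
    simp only [add_zero, one_pow, mul_one, ne_eq, OfNat.ofNat_ne_zero, not_false_eq_true, zero_pow,
      zero_div, neg_zero, Real.exp_zero] at h
    exact (abs_nonneg _).trans h
  have hIabs := arnoldGauss_integrableOn_abs_mul hac hab
  set Ka : ℝ := ∫ s in Ioi (0:ℝ), |a s| * s with hKa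
  have hKa0 : 0 ≤ Ka := setIntegral_nonneg measurableSet_Ioi fun s hs => mul_nonneg (abs_nonneg _) hs.le
  have hB1 : ∀ r, 0 < r → |∫ s in Ioi (0:ℝ), min (r / s) (s / r) * a s * s| ≤ Ka := by
    intro r hr
    rw [← Real.norm_eq_abs]
    refine norm_integral_le_of_norm_le hIabs ((ae_restrict_iff' measurableSet_Ioi).2
      (Eventually.of_forall fun s hs => ?_))
    have hm := arnoldGauss_min_mem_Icc hr hs
    rw [Real.norm_eq_abs, abs_mul, abs_mul, abs_of_nonneg hm.1, abs_of_pos (show (0:ℝ) < s from hs)]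
    calc min (r / s) (s / r) * |a s| * s ≤ 1 * |a s| * s :=
          mul_le_mul_of_nonneg_right (mul_le_mul_of_nonneg_right hm.2 (abs_nonneg _)) (le_of_lt hs)
      _ = |a s| * s := by ring
  have hmeas : AEStronglyMeasurable
      (fun r => ((1 / 2 : ℝ) * ∫ s in Ioi (0:ℝ), min (r / s) (s / r) * a s * s) * a r * r)
      (volume.restrict (Ioi (0:ℝ))) :=
    (((aestronglyMeasurable_const (b := (1 / 2 : ℝ))).mul (arnoldGauss_aestronglyMeasurable_B1 hac)).mul
      ((hac.mono Ioi_subset_Ici_self).aestronglyMeasurable measurableSet_Ioi)).mul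
      (continuousOn_id.aestronglyMeasurable measurableSet_Ioi)
  refine arnoldGauss_integrableOn_of_gaussBound hmeas (by positivity : (0:ℝ) ≤ 1 / 2 * Ka * C) (N + 1)
    fun r hr => ?_
  rw [abs_mul, abs_mul, abs_mul, abs_of_pos hr, abs_of_pos (by norm_num : (0:ℝ) < 1 / 2)]
  have h1 := hB1 r hr
  have h2 := hab r hr.le
  calc 1 / 2 * |∫ s in Ioi (0:ℝ), min (r / s) (s / r) * a s * s| * |a r| * r
      ≤ 1 / 2 * Ka * (C * (1 + r) ^ N * Real.exp (-(r ^ 2 / 4))) * (1 + r) := by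
        refine mul_le_mul (mul_le_mul (by gcongr) h2 (abs_nonneg _) (by positivity)) (by linarith) hr.le
          (by positivity)
    _ = 1 / 2 * Ka * C * (1 + r) ^ (N + 1) * Real.exp (-(r ^ 2 / 4)) := by ring

end Radial

/-! ### The assembly -/

/-- **Gallay–Šverák's Theorem 2.5 (with Remark 2.7) at the Gaussian vortex, for odd densities**
(registered skeleton stub `stub_gallaySverak2021` of line `Sketch`, crux `CoreLinearInvertibility`;
discharges the named Literature fact `GallaySverak2021_thm25_gaussian`): there is `γ > 0` with
`γ ∫ Φ⁻¹ ω² ≤ ∫ Φ⁻¹ ω² + ∫ ω ψ_ω` for every continuous, odd, Gaussian-class `ω` with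
`∫ x₀ ω = ∫ x₁ ω = 0`. Proof: `γ = min(γ₁, 1/20)`; split `ω = ω₁ + ω_r` (`stub_arnoldModeSplit`),
apply the one-dimensional constrained coercivity to `a` and `b` (`stub_arnoldModeOne1D`) and the
explicit high-mode coercivity to `ω_r` (`stub_arnoldHighModes`). -/
theorem stub_gallaySverak2021 : Literature.Analysis.FluidPDE.GallaySverak2021_thm25_gaussian := by
  obtain ⟨γ₁, hγ₁, h1D⟩ := stub_arnoldModeOne1D
  refine ⟨min γ₁ (1 / 20), lt_min hγ₁ (by norm_num), fun om homc homg homo hm0 hm1 => ?_⟩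
  -- the splitting data
  obtain ⟨a, ha⟩ : ∃ a : ℝ → ℝ,
      a = fun r => (1 / Real.pi) * ∫ θ in (-Real.pi)..Real.pi, om (circlePt r θ) * Real.cos θ := ⟨_, rfl⟩
  obtain ⟨b, hb⟩ : ∃ b : ℝ → ℝ,
      b = fun r => (1 / Real.pi) * ∫ θ in (-Real.pi)..Real.pi, om (circlePt r θ) * Real.sin θ := ⟨_, rfl⟩
  obtain ⟨om₁, hom₁⟩ : ∃ om₁ : EuclideanSpace ℝ (Fin 2) → ℝ,
      om₁ = fun x => (a ‖x‖ * x 0 + b ‖x‖ * x 1) / ‖x‖ := ⟨_, rfl⟩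
  obtain ⟨omr, homr⟩ : ∃ omr : EuclideanSpace ℝ (Fin 2) → ℝ, omr = fun x => om x - om₁ x := ⟨_, rfl⟩
  obtain ⟨hac, hbc, ⟨C, N, hab⟩, homrc, homrg, homro, homrm, hma, hmb, hnorm, henergy⟩ :=
    stub_arnoldModeSplit om a b om₁ omr homc homg homo hm0 hm1 (fun r => by rw [ha]) (fun r => by rw [hb])
      (fun x => by rw [hom₁]) (fun x => by rw [homr])
  -- the three coercivities
  have hA := h1D a hac ⟨C, N, fun r hr => (hab r hr).1⟩ hma
  have hB := h1D b hbc ⟨C, N, fun r hr => (hab r hr).2⟩ hmb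
  have hR := stub_arnoldHighModes omr homrc homrg homro homrm
  -- splitting the one-dimensional integrals
  have hISa := arnoldGauss_integrableOn_normIntegrand hac (fun r hr => (hab r hr).1)
  have hISb := arnoldGauss_integrableOn_normIntegrand hbc (fun r hr => (hab r hr).2)
  have hITa := arnoldGauss_integrableOn_energyIntegrand hac (fun r hr => (hab r hr).1)
  have hITb := arnoldGauss_integrableOn_energyIntegrand hbc (fun r hr => (hab r hr).2)
  have hSab : ∫ r in Ioi (0:ℝ), (kerWeight r)⁻¹ * (a r ^ 2 + b r ^ 2) * r =
      (∫ r in Ioi (0:ℝ), (kerWeight r)⁻¹ * a r ^ 2 * r) + ∫ r in Ioi (0:ℝ), (kerWeight r)⁻¹ * b r ^ 2 * r := by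
    rw [← integral_add hISa hISb]
    exact integral_congr_ae (Eventually.of_forall fun r => by ring)
  have hTab : ∫ r in Ioi (0:ℝ),
      (((1 / 2 : ℝ) * ∫ s in Ioi (0:ℝ), min (r / s) (s / r) * a s * s) * a r +
        ((1 / 2 : ℝ) * ∫ s in Ioi (0:ℝ), min (r / s) (s / r) * b s * s) * b r) * r =
      (∫ r in Ioi (0:ℝ), ((1 / 2 : ℝ) * ∫ s in Ioi (0:ℝ), min (r / s) (s / r) * a s * s) * a r * r) +
        ∫ r in Ioi (0:ℝ), ((1 / 2 : ℝ) * ∫ s in Ioi (0:ℝ), min (r / s) (s / r) * b s * s) * b r * r := by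
    rw [← integral_add hITa hITb]
    exact integral_congr_ae (Eventually.of_forall fun r => by ring)
  rw [hnorm, henergy, hSab, hTab]
  -- signs
  have hSa0 : 0 ≤ ∫ r in Ioi (0:ℝ), (kerWeight r)⁻¹ * a r ^ 2 * r :=
    setIntegral_nonneg measurableSet_Ioi fun r hr =>
      mul_nonneg (mul_nonneg (inv_nonneg.2 (kerWeight_pos r).le) (sq_nonneg _)) (le_of_lt hr)
  have hSb0 : 0 ≤ ∫ r in Ioi (0:ℝ), (kerWeight r)⁻¹ * b r ^ 2 * r :=
    setIntegral_nonneg measurableSet_Ioi fun r hr =>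
      mul_nonneg (mul_nonneg (inv_nonneg.2 (kerWeight_pos r).le) (sq_nonneg _)) (le_of_lt hr)
  have hSr0 : 0 ≤ ∫ x, (kerWeight ‖x‖)⁻¹ * omr x ^ 2 :=
    integral_nonneg fun x => mul_nonneg (inv_nonneg.2 (kerWeight_pos _).le) (sq_nonneg _)
  -- bookkeeping
  set Sa := ∫ r in Ioi (0:ℝ), (kerWeight r)⁻¹ * a r ^ 2 * r with hSa
  set Sb := ∫ r in Ioi (0:ℝ), (kerWeight r)⁻¹ * b r ^ 2 * r with hSb
  set Ta := ∫ r in Ioi (0:ℝ), ((1 / 2 : ℝ) * ∫ s in Ioi (0:ℝ), min (r / s) (s / r) * a s * s) * a r * r with hTa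
  set Tb := ∫ r in Ioi (0:ℝ), ((1 / 2 : ℝ) * ∫ s in Ioi (0:ℝ), min (r / s) (s / r) * b s * s) * b r * r with hTb
  set Sr := ∫ x, (kerWeight ‖x‖)⁻¹ * omr x ^ 2 with hSr
  set Jr := ∫ x, omr x * ∫ y, (2 * Real.pi)⁻¹ * Real.log ‖x - y‖ * omr y with hJr
  have hπ := Real.pi_pos
  have k1 : min γ₁ (1 / 20) * (Real.pi * (Sa + Sb)) ≤ γ₁ * (Real.pi * (Sa + Sb)) :=
    mul_le_mul_of_nonneg_right (min_le_left _ _) (by positivity)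
  have k2 : min γ₁ (1 / 20) * Sr ≤ 1 / 20 * Sr := mul_le_mul_of_nonneg_right (min_le_right _ _) hSr0
  have k3 : Real.pi * (Ta + Tb) ≤ Real.pi * ((1 - γ₁) * (Sa + Sb)) :=
    mul_le_mul_of_nonneg_left (by linarith) hπ.le
  have k4 : γ₁ * (Real.pi * (Sa + Sb)) = Real.pi * (Sa + Sb) - Real.pi * ((1 - γ₁) * (Sa + Sb)) := by ring
  calc min γ₁ (1 / 20) * (Real.pi * (Sa + Sb) + Sr)
      = min γ₁ (1 / 20) * (Real.pi * (Sa + Sb)) + min γ₁ (1 / 20) * Sr := by ring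
    _ ≤ γ₁ * (Real.pi * (Sa + Sb)) + 1 / 20 * Sr := add_le_add k1 k2
    _ ≤ Real.pi * (Sa + Sb) + Sr + (-(Real.pi * (Ta + Tb)) + Jr) := by linarith

end Summit.NavierStokesRegularity.NavierStokesRegularity.Theorems
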